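import Literature.AlgebraicGeometry.Frobenioids.CircleOpensConditionsAB
import Literature.AlgebraicGeometry.Frobenioids.CircleOpensCondClosures
import Literature.AlgebraicGeometry.Frobenioids.ArchimedeanFSMRepaired
import Literature.AlgebraicGeometry.Frobenioids.ArchimedeanFSMItemIIIPointwise
import Literature.AlgebraicGeometry.Frobenioids.ArchimedeanFrobenioidStatements
import Literature.AlgebraicGeometry.Frobenioids.CoAngular
import HarnessLib

/-!
# Frobenioids II, §3: the HYPOTHESIS predicates of Lemma 3.2 (vi) (conditions (a)–(d)) and of
# Proposition 3.4 (ii) (conditions (a), (b)) — print-generality closers and instances at the genuine towers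

Mochizuki, *The geometry of Frobenioids II: poly-Frobenioids*, Kyushu J. Math. **62** (2008) 401–460, §3
(author's kurims text): Lemma 3.2 (vi) p. 25 l. 37 – p. 26, proof p. 26 ll. 29–30
[cite: MochizukiFrdII2008, Lem 3.2 (vi) pp.25-26]; Proposition 3.4 (ii) p. 30 l. 2, proof p. 30 l. 30 – p. 31 l. 7
[cite: MochizukiFrdII2008, Prop 3.4 (ii) p.30].

> Lemma 3.2 (vi): "Suppose that `A ≠ B`. Then consider the following conditions on the pair `(A, B)`:
> (a) … `A₁ ⊆ A₂` or `A₂ ⊆ A₁`. (b) … there exists an `(A₁, A₂)`-subset `A₃` such that `A₁ ≠ A₃`, `A₂ ≠ A₃`.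
> (c) The complement `B \ A` is connected. (d) If `B = S¹`, then `B \ A` is of cardinality `≤ 1`. (e) `B ≠ S¹`.
> Then (a) holds if and only if both (c) and (d) hold; both (a) and (b) hold if and only if both (c) and (e)
> hold."
> Proposition 3.4 (ii): "Suppose that `φ` is a monomorphism of `F` that satisfies at least one of the
> following two conditions: (a) `φ` projects to an isomorphism of `D₀`; (b) `φ` admits a factorization
> `A → A′ → B` as a composite of a morphism of Frobenius type `A → A′` and a linear morphism `A′ → B` such
> that any isotropic hull `A′ → A″` of `A′` is either an isomorphism or a slit morphism. Then `φ` projects to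
> a monomorphism `φ_D` of `D`."

WHY THIS FILE (abc-iut cell, D-0079 sub-cell L-F [FrdI/II], table `plan/L1/LF-FRD.tsv` pack A, seat
abc-iut-L1-t2 gen 11; FACT rows F-0984 `CircleOpens.CondA`, F-0985 `CircleOpens.CondB`, F-0986
`CircleOpens.CondC`, F-0987 `CircleOpens.CondD`, F-0804 `ArchFrd.Tower.CondA`, F-0805 `ArchFrd.Tower.CondB`).
These six declarations are not claims of print: they are the HYPOTHESES (a)–(d) of Lemma 3.2 (vi) (predicates
of a pair of subsets of `S¹`) and (a), (b) of Proposition 3.4 (ii) (predicates of an arrow of a tower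
`F ∈ {A, N, R}`), typed as parametrised `Prop`s (seats abc-iut-L1-t4 / abc-iut-L1-t6).  Their universal
closures are refuted in the tree (`CircleOpens.not_forall_condA` …, `ArchFrd.Tower.not_forall_condA/B`), as
print itself requires (Rmk. 3.4.1).  What the kernel can honestly record about a hypothesis predicate is
(1) WHEN it holds in print generality — for (a)–(d) this is exactly the content of Lemma 3.2 (vi), already
PROVED as the `Iff`s `CircleOpens.condA_iff_condC_and_condD`, `condB_iff_condE` (seat abc-iut-f-028/029,
`CircleOpensConditionsAB.lean`, `CircleOpensCondClosures.lean`) — and (2) that it is SATISFIABLE at the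
genuine carriers the cone consumes (the towers `towerA π`, `towerN π`, `towerR π` of Prop. 3.4 over an
arbitrary base `π : D → D₀`).  This file re-heads (1) so that the conclusion HEAD is the condition itself
(one line each; the cell's head-matcher reads heads mechanically) and proves (2):

* `CircleOpens.condA_of_condC_of_condD`, `condC_of_condA`, `condD_of_condA`, `condB_of_condC_of_condE`,
  `condA_of_isContinuouslyOrdered`, `condB_of_isContinuouslyOrdered` (Lemma 3.2 (vi) by name);
* `ArchFrd.Tower.condA_id`, `Tower.condA_of_isIso_toD` (condition (a): identities / arrows over
  isomorphisms of `D` project to isomorphisms of `D₀`; the complex-regime closers `Tower.condA_of_isComplex`,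
  `Tower.condA_of_isComplex_cod` are already in the tree and only cited);
* `ArchFrd.Tower.isFrobeniusType_id` (an identity of a totally epimorphic `F` is of Frobenius type),
  `Tower.condB_of_isIsotropic`, `Tower.condB_of_isSlitRegion`, `Tower.condB_id_of_isIsotropic` — condition
  (b) HOLDS for every linear arrow out of an isotropic object (its isotropic hulls are isomorphisms) and for
  every linear arrow out of an object with slit angular region (its isotropic hulls are slit morphisms by
  definition), in ANY tower with `F` totally epimorphic — and the instances at the three genuine towers
  under print's standing hypothesis "`D` totally epimorphic" (Ex. 3.3 (ii) p. 28; `ArchFrd.isTotallyEpimorphic_all`):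
  `towerA_condB_of_isIsotropic`, `towerN_condB_of_isIsotropic`, `towerR_condB_of_isIsotropic`,
  `towerA_condB_of_isSlitRegion`, `towerN_condB_of_isSlitRegion`, `towerR_condB_of_isSlitRegion`.

PROOF-ONLY: no `def`, no new `Prop`, no restated schema.  Honest framing: FACT rows are assumption LABELS on
OUR typed statements of the refereed [FrdII]; "proved" = OUR kernel check of OUR typed instance form; nothing
here asserts abc proved or refuted; no side taken on [IUTchIII] Cor. 3.12; typed ≠ proved.
-/

namespace Literature.AlgebraicGeometry.Frobenioids

open CategoryTheory Set

/-! ### Lemma 3.2 (vi): conditions (a)–(d) by name, in print generality -/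

namespace CircleOpens

variable {A B : Set Circle}

/-- **Lemma 3.2 (vi), (c) ∧ (d) ⇒ (a)** (p. 25 l. 37: "(a) holds if and only if both (c) and (d) hold"), for
`A ≠ B` [nonempty connected open, `A ⊆ B`]. [cite: MochizukiFrdII2008, Lem 3.2 (vi) p.25] -/
theorem condA_of_condC_of_condD (h : Setting A B) (hne : A ≠ B) (hc : CondC A B) (hd : CondD A B) :
    CondA A B :=
  (condA_iff_condC_and_condD h hne).mpr ⟨hc, hd⟩

/-- **Lemma 3.2 (vi), (a) ⇒ (c)** (p. 25 l. 37), for `A ≠ B`. [cite: MochizukiFrdII2008, Lem 3.2 (vi) p.26] -/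
theorem condC_of_condA (h : Setting A B) (hne : A ≠ B) (ha : CondA A B) : CondC A B :=
  ((condA_iff_condC_and_condD h hne).mp ha).1

/-- **Lemma 3.2 (vi), (a) ⇒ (d)** (p. 25 l. 37), for `A ≠ B`. [cite: MochizukiFrdII2008, Lem 3.2 (vi) p.26] -/
theorem condD_of_condA (h : Setting A B) (hne : A ≠ B) (ha : CondA A B) : CondD A B :=
  ((condA_iff_condC_and_condD h hne).mp ha).2

/-- **Lemma 3.2 (vi), (c) ∧ (e) ⇒ (b)** (p. 26: "both (a) and (b) hold if and only if both (c) and (e)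
hold"); in fact (e) "`B ≠ S¹`" alone gives (b) (`condB_of_ne_univ`). [cite: MochizukiFrdII2008, Lem 3.2 (vi) p.26] -/
theorem condB_of_condC_of_condE (h : Setting A B) (_hc : CondC A B) (he : CondE A B) : CondB A B :=
  condB_of_ne_univ h he

/-- **Lemma 3.2 (vi), (c) ∧ (e) ⇒ (a)** (p. 26), for `A ≠ B`: (e) makes (d) vacuous.
[cite: MochizukiFrdII2008, Lem 3.2 (vi) p.26] -/
theorem condA_of_condC_of_condE (h : Setting A B) (hne : A ≠ B) (hc : CondC A B) (he : CondE A B) :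
    CondA A B :=
  condA_of_condC_of_condD h hne hc (condD_of_ne_univ he)

/-- A continuously ordered pair satisfies (a) (Lemma 3.2 (vi), definition, p. 26: "if the pair `(A, B)`
satisfies conditions (a) and (b), then we shall say that the pair `(A, B)` is continuously ordered").
[cite: MochizukiFrdII2008, Lem 3.2 (vi) p.26] -/
theorem condA_of_isContinuouslyOrdered (h : IsContinuouslyOrdered A B) : CondA A B := h.2.2.1

/-- A continuously ordered pair satisfies (b). [cite: MochizukiFrdII2008, Lem 3.2 (vi) p.26] -/
theorem condB_of_isContinuouslyOrdered (h : IsContinuouslyOrdered A B) : CondB A B := h.2.2.2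

/-- A continuously ordered pair satisfies (c) (Lemma 3.2 (vi): (a) ⇒ (c)). [cite: MochizukiFrdII2008, Lem 3.2 (vi) p.26] -/
theorem condC_of_isContinuouslyOrdered (h : IsContinuouslyOrdered A B) : CondC A B :=
  condC_of_condA h.1 h.2.1 h.2.2.1

/-- A continuously ordered pair satisfies (d) (Lemma 3.2 (vi): (a) ⇒ (d)). [cite: MochizukiFrdII2008, Lem 3.2 (vi) p.26] -/
theorem condD_of_isContinuouslyOrdered (h : IsContinuouslyOrdered A B) : CondD A B :=
  condD_of_condA h.1 h.2.1 h.2.2.1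

end CircleOpens

/-! ### Proposition 3.4 (ii): conditions (a), (b) at the towers `F ∈ {A, N, R}` -/

noncomputable section

namespace ArchFrd

universe v u

variable {D : Type u} [Category.{v} D] (π : D ⥤ D0)

namespace Tower

variable {π} (T : Tower π)

/-- Condition (a) of Prop. 3.4 (ii) ("`φ` projects to an isomorphism of `D₀`", p. 30 l. 2) holds for every
identity arrow of `F`. [cite: MochizukiFrdII2008, Prop 3.4 (ii) p.30] -/
theorem condA_id (X : T.F) : T.CondA (𝟙 X) := by
  change IsIso (T.toD0.map (𝟙 X))
  rw [CategoryTheory.Functor.map_id]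
  infer_instance

/-- Condition (a) of Prop. 3.4 (ii) holds for every arrow of `F` projecting to an isomorphism of `D` (a
fortiori of `D₀`). [cite: MochizukiFrdII2008, Prop 3.4 (ii) p.30] -/
theorem condA_of_isIso_toD {X Y : T.F} (φ : X ⟶ Y) [IsIso (T.toD.map φ)] : T.CondA φ := by
  change IsIso (π.map (T.toD.map φ))
  infer_instance

/-- In a tower whose category `F` is totally epimorphic, every identity arrow is a morphism of Frobenius type
for the structure `T.str` ([FrdI] Def. 1.2 (iii): LB-invertible base-isomorphism; an isomorphism of a totally
epimorphic category is co-angular, [FrdI] §0). [cite: MochizukiFrdII2008, Prop 3.4 (ii) p.30] -/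
theorem isFrobeniusType_id (hT : IsTotallyEpimorphic T.F) (X : T.F) :
    PreFrobenioid.IsFrobeniusType T.str (𝟙 X) :=
  ⟨⟨PreFrobenioid.isCoAngular_of_isIso T.str hT (𝟙 X), PreFrobenioid.div_id T.str X⟩,
    PreFrobenioid.isBaseIso_of_isIso T.str (𝟙 X)⟩

/-- **Condition (b) of Prop. 3.4 (ii) HOLDS for every linear arrow `φ : X → Y` out of an ISOTROPIC object**
(`F` totally epimorphic): the factorization `X = X → Y` ("a morphism of Frobenius type `A → A′`" = the
identity, "a linear morphism `A′ → B`" = `φ`), and "any isotropic hull `A′ → A″` of `A′` is … an isomorphism"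
because `A′ = X` is isotropic ([FrdI] Def. 1.2 (iv)). [cite: MochizukiFrdII2008, Prop 3.4 (ii) p.30] -/
theorem condB_of_isIsotropic (hT : IsTotallyEpimorphic T.F) {X Y : T.F} (φ : X ⟶ Y)
    (hφ : PreFrobenioid.IsLinear T.str φ) (hX : PreFrobenioid.IsIsotropic T.str X) : T.CondB φ :=
  ⟨X, 𝟙 X, φ, Category.id_comp φ, T.isFrobeniusType_id hT X, hφ,
    fun _ h hh => Or.inl (hX h hh.1 hh.2.1)⟩

/-- **Condition (b) of Prop. 3.4 (ii) HOLDS for every linear arrow out of an object with SLIT angular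
region** (`F` totally epimorphic): with the trivial factorization, "any isotropic hull `A′ → A″` of `A′` is …
a slit morphism" by the definition of slit morphisms (Ex. 3.3 (v): isotropic hulls of objects with slit
angular region). [cite: MochizukiFrdII2008, Prop 3.4 (ii) p.30] -/
theorem condB_of_isSlitRegion (hT : IsTotallyEpimorphic T.F) {X Y : T.F} (φ : X ⟶ Y)
    (hφ : PreFrobenioid.IsLinear T.str φ) (hX : IsSlitRegion (T.region X)) : T.CondB φ :=
  ⟨X, 𝟙 X, φ, Category.id_comp φ, T.isFrobeniusType_id hT X, hφ, fun _ _ hh => Or.inr ⟨hh, hX⟩⟩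

/-- Condition (b) of Prop. 3.4 (ii) holds for the identity of an isotropic object (`F` totally epimorphic).
[cite: MochizukiFrdII2008, Prop 3.4 (ii) p.30] -/
theorem condB_id_of_isIsotropic (hT : IsTotallyEpimorphic T.F) (X : T.F)
    (hX : PreFrobenioid.IsIsotropic T.str X) : T.CondB (𝟙 X) :=
  T.condB_of_isIsotropic hT (𝟙 X) (PreFrobenioid.degFr_id T.str X) hX

/-- Condition (b) of Prop. 3.4 (ii) holds for the identity of an object with slit angular region (`F`
totally epimorphic). [cite: MochizukiFrdII2008, Prop 3.4 (ii) p.30] -/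
theorem condB_id_of_isSlitRegion (hT : IsTotallyEpimorphic T.F) (X : T.F)
    (hX : IsSlitRegion (T.region X)) : T.CondB (𝟙 X) :=
  T.condB_of_isSlitRegion hT (𝟙 X) (PreFrobenioid.degFr_id T.str X) hX

end Tower

/-! ### The three genuine towers `F = A, N, R` over a totally epimorphic base `D` (Ex. 3.3 (ii), p. 28:
"Let `D` be a connected, totally epimorphic category"; total epimorphicity of `A`, `N`, `R` is Ex. 3.3 (iv),
`ArchFrd.isTotallyEpimorphic_all`) -/

/-- Condition (b) of Prop. 3.4 (ii) at `F = A` (the angular Frobenioid): every linear arrow out of an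
isotropic object of `A` satisfies (b). [cite: MochizukiFrdII2008, Prop 3.4 (ii) p.30] -/
theorem towerA_condB_of_isIsotropic (hD : IsTotallyEpimorphic D) {X Y : (towerA π).F} (φ : X ⟶ Y)
    (hφ : PreFrobenioid.IsLinear (towerA π).str φ) (hX : PreFrobenioid.IsIsotropic (towerA π).str X) :
    (towerA π).CondB φ :=
  (towerA π).condB_of_isIsotropic (isTotallyEpimorphic_all π hD).2.1 φ hφ hX

/-- Condition (b) of Prop. 3.4 (ii) at `F = N` (the non-rigidified angloid; words read in `C`).
[cite: MochizukiFrdII2008, Prop 3.4 (ii) p.30] -/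
theorem towerN_condB_of_isIsotropic (hD : IsTotallyEpimorphic D) {X Y : (towerN π).F} (φ : X ⟶ Y)
    (hφ : PreFrobenioid.IsLinear (towerN π).str φ) (hX : PreFrobenioid.IsIsotropic (towerN π).str X) :
    (towerN π).CondB φ :=
  (towerN π).condB_of_isIsotropic (isTotallyEpimorphic_all π hD).2.2.1 φ hφ hX

/-- Condition (b) of Prop. 3.4 (ii) at `F = R` (the rigidified angloid; words read in `C`).
[cite: MochizukiFrdII2008, Prop 3.4 (ii) p.30] -/
theorem towerR_condB_of_isIsotropic (hD : IsTotallyEpimorphic D) {X Y : (towerR π).F} (φ : X ⟶ Y)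
    (hφ : PreFrobenioid.IsLinear (towerR π).str φ) (hX : PreFrobenioid.IsIsotropic (towerR π).str X) :
    (towerR π).CondB φ :=
  (towerR π).condB_of_isIsotropic (isTotallyEpimorphic_all π hD).2.2.2 φ hφ hX

/-- Condition (b) of Prop. 3.4 (ii) at `F = A` for linear arrows out of objects with slit angular region.
[cite: MochizukiFrdII2008, Prop 3.4 (ii) p.30] -/
theorem towerA_condB_of_isSlitRegion (hD : IsTotallyEpimorphic D) {X Y : (towerA π).F} (φ : X ⟶ Y)
    (hφ : PreFrobenioid.IsLinear (towerA π).str φ) (hX : IsSlitRegion ((towerA π).region X)) :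
    (towerA π).CondB φ :=
  (towerA π).condB_of_isSlitRegion (isTotallyEpimorphic_all π hD).2.1 φ hφ hX

/-- Condition (b) of Prop. 3.4 (ii) at `F = N` for linear arrows out of objects with slit angular region.
[cite: MochizukiFrdII2008, Prop 3.4 (ii) p.30] -/
theorem towerN_condB_of_isSlitRegion (hD : IsTotallyEpimorphic D) {X Y : (towerN π).F} (φ : X ⟶ Y)
    (hφ : PreFrobenioid.IsLinear (towerN π).str φ) (hX : IsSlitRegion ((towerN π).region X)) :
    (towerN π).CondB φ :=
  (towerN π).condB_of_isSlitRegion (isTotallyEpimorphic_all π hD).2.2.1 φ hφ hX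

/-- Condition (b) of Prop. 3.4 (ii) at `F = R` for linear arrows out of objects with slit angular region.
[cite: MochizukiFrdII2008, Prop 3.4 (ii) p.30] -/
theorem towerR_condB_of_isSlitRegion (hD : IsTotallyEpimorphic D) {X Y : (towerR π).F} (φ : X ⟶ Y)
    (hφ : PreFrobenioid.IsLinear (towerR π).str φ) (hX : IsSlitRegion ((towerR π).region X)) :
    (towerR π).CondB φ :=
  (towerR π).condB_of_isSlitRegion (isTotallyEpimorphic_all π hD).2.2.2 φ hφ hX

/-- Condition (a) of Prop. 3.4 (ii) at the three genuine towers for identity arrows (any base).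
[cite: MochizukiFrdII2008, Prop 3.4 (ii) p.30] -/
theorem towers_condA_id :
    (∀ X : (towerA π).F, (towerA π).CondA (𝟙 X)) ∧ (∀ X : (towerN π).F, (towerN π).CondA (𝟙 X)) ∧
      ∀ X : (towerR π).F, (towerR π).CondA (𝟙 X) :=
  ⟨(towerA π).condA_id, (towerN π).condA_id, (towerR π).condA_id⟩

end ArchFrd

end

end Literature.AlgebraicGeometry.Frobenioids
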